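import Summits.BirchSwinnertonDyer.Rank1Residual.X11b.ClassClosureSymbolTablePeriodUnit
import Summits.BirchSwinnertonDyer.Rank1Residual.X11a.PrintDischargeMuAn
import HarnessLib

/-!
# Class X11a — the PRINT route's discharge interface, part 8: the μ-claim DERIVED from a displayed
# SYMBOL TABLE (the Mazur–Tate–Teitelbaum dictionary in the kernel), and the table doors on the
# non-surjective sub-leaf

Cell `bsd-print-x11a` (D-0131 print tier), seat ty2 (the DISCHARGE INTERFACE). THEOREMS ONLY (no
definition, no named fact, no `sorry`). Sequel of parts 6–7 (`PrintDischargeMuAn.lean`: the μ-claim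
`X11a.MuAnZeroAt W p` ⇒ crux-U currency on the non-surjective sub-leaf; `PrintDischargeMuAnRecords.lean`:
record consumers of `Record.MuClaim`). lit g6 TURNKEY T33 (HOME/DOSSIER.md §33; sketch
`HOME/staging/lit/t33/PrintDischargeMuTableSketch.lean`, taken here VERBATIM as §1): the μ-DICTIONARY
«a unit Teichmüller-coset (Riemann) sum at a level `p^{n₀} > k` ⇒ the coefficient of `T^k` in
`ϖ·L_p` is a `p`-adic unit» (MTT §I.10 Prop., §I.12–I.14; the `P_{n+1} ≡ P_n mod ω_n` compatibility
via Lucas) is ALREADY a tree theorem — the sister cell b2b-bsdres' X11b class-closure road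
`X11b.ClassClosure.unitCoeffAt_of_symbolTable_modP` / `X11b.muAnZeroAt_of_symbolTable_modP`, with the
period unit `‖ϖ₀‖_p = 1` from Mazur's fact (`X11b.ClassClosure.norm_ratCast_periodRatio_eq_one_of_mazur`)
— except that X11b fed the all-levels symbol bound from analytic rank `≠ 0`; at `r_an = 0` the bound
is `IsNewformOf.norm_ratPlusSymbol_val_div_le_max_of_multiplicative` (`C = max(1, ‖[0]⁺‖)`, and
`x 0 = lRatio ∈ ℤ` makes `C = 1`). So the certificate schema's `Record.MuClaim` («standard but NOT a
tree theorem … hence a claim», `ClaimMu.lean`) need not be ASSUMED: it can be DERIVED from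
(i) the IDENTIFICATION `hx : ∀ r, x r = u·ϖ₀·[r]⁺_{f₀}` of an engine's rational symbol table `x`
with the newform's plus symbol (the one irreducibly displayed datum — carried by the two-engine
discipline), (ii) `‖x 0‖_p ≤ 1`, (iii) ONE level `n₀` with the exact Riemann sums `RS` of `x`, an
index `k < p^{n₀}` and `‖RS k n₀‖_p = 1`, (iv) Mazur's named fact `mazur_not_dvd_maninConstant_of_odd`.

* §1 (lit g6's sketch, rank-free twins of the X11b road): `X11a.norm_symbolTable_le_max`,
  `X11a.unitCoeffAt_of_symbolTable_rankFree`, **`X11a.muAnZeroAt_of_symbolTable_of_mazur_rankFree`**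
  (`… → X11a.MuAnZeroAt W p`; hypotheses `hM`, `p ≠ 2`, `Mult`, `Irr`, `hf₀ hϖ₀ hu hx hx0`, and per
  reduction sign the data `∃ n₀ RS, RS = (the Riemann sums of x) ∧ k < p^{n₀} ∧ ‖RS k n₀‖ = 1`).
* §2 the doors on the class: `ClassX11a.muAnZeroAt_of_symbolTable` (`p ≠ 2`, `Mult`, `Irr` from the
  class) and the crux-U compositions with part 6 BY REGIME —
  **`ClassX11a.missingUpperBoundAt_of_symbolTable_of_not_surj_of_nonsplit`** (signed sums, index `n`,
  NO Greenberg–Stevens binder) and **`ClassX11a.missingUpperBoundAt_of_symbolTable_of_not_surj_of_split`**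
  (unsigned sums, index `n + 1` past the trivial zero, `hGS`), each with the table data as explicit
  binders `n n₀ RS hRS hk hunit` (no existential to build at the call site).

Displayed per pair after this part: the ten facts [+ GS if split], Mazur's fact, the class, the image
bit, the split bit, `hf₀`/`hϖ₀` (a newform and its period ratio — existentially available from
`nonempty_modularParametrizationData`, kept explicit because `hx` refers to them), the unit `u`
(`±2^j`, `X11b.ClassClosure.norm_ratCast_mul_two_pow_eq_one`), the table identification `hx`,
`‖x 0‖ ≤ 1`, and `(n₀, RS, hRS, hk, hunit)`. HONEST FRAMING: per pair (E1 currency); `hx` is an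
engine claim, not a kernel fact; nothing here proves `μ = 0` class-wide; the leaf `ClassX11a` stays
open; BSD is not proved by any of this. beyond-print theorem: no.

References: [MazurTateTeitelbaum1986Invent] §I.4 (4.2), §I.8, §I.10 Prop., §I.12–I.14;
[SteinWuthrich2013] §3, §4.2; [Mazur1978] Cor. 4.1; [GreenbergVatsal2000] pp. 2–3; [Kato2004Asterisque]
§17.13; [Wuthrich2014] Cor. 18; [Miller2011LMS] Def. 1.1; cell files `pub/bsd-print-x11a/DOSSIER.md` §26,
§33, `TY2-DISCHARGE-INTERFACE.md` §J–§K, `staging/lit/t33/README.md`.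
-/

set_option autoImplicit false

noncomputable section

open scoped Classical MatrixGroups ModularForm

open CongruenceSubgroup WeierstrassCurve Literature.NumberTheory.EllipticCurves
  Literature.NumberTheory.EllipticCurves.ModularForms
  Literature.NumberTheory.EllipticCurves.Rank1Residual
  Literature.NumberTheory.EllipticCurves.Rank1Residual.Typed
  Literature.NumberTheory.EllipticCurves.Wuthrich2014
  Literature.NumberTheory.EllipticCurves.SteinWuthrich2013
  Literature.NumberTheory.EllipticCurves.Greenberg1999
  Literature.NumberTheory.EllipticCurves.Kato2004

namespace Summit.BirchSwinnertonDyer.Rank1Residual.X11a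

/-! ### §1 The rank-free symbol-table road (lit g6, TURNKEY T33 sketch, verbatim) -/
-- adapted from HOME/staging/lit/t33/PrintDischargeMuTableSketch.lean (lit g6, 2026-08-27T18:00Z; lean check rc 0 there)

section RankFree

variable (W : WeierstrassCurve ℚ) [W.IsElliptic] (p : ℕ) [Fact p.Prime]

omit [W.IsElliptic] in
/-- **All-levels bound on the symbol table, ANY analytic rank**: `‖x(a/p^m)‖_p ≤ max(‖ϖ₀‖_p, ‖x 0‖_p)`
for `x = u·ϖ₀·[·]⁺_{f₀}`, `‖u‖_p = 1`, at an odd multiplicative prime.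
[cite: MazurTateTeitelbaum1986Invent, §I.4 (4.2), §I.8 and §I.10] -/
theorem norm_symbolTable_le_max (hp2 : p ≠ 2)
    (hmult : W.HasMultiplicativeReductionAtPrime p)
    {N₀ : ℕ} [NeZero N₀] {f₀ : CuspForm (Gamma0 N₀) 2} (hf₀ : IsNewformOf W f₀) {ϖ₀ u : ℚ}
    (hu : ‖((u : ℚ) : ℚ_[p])‖ = 1) {x : ℚ → ℚ} (hx : ∀ r : ℚ, x r = u * ϖ₀ * ratPlusSymbol f₀ r)
    (m : ℕ) (a : ZMod (p ^ m)) :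
    ‖(x ((a.val : ℚ) / (p : ℚ) ^ m) : ℚ_[p])‖ ≤
      max ‖((ϖ₀ : ℚ) : ℚ_[p])‖ ‖(x 0 : ℚ_[p])‖ := by
  have h0 : ‖(x 0 : ℚ_[p])‖ = ‖((ϖ₀ : ℚ) : ℚ_[p])‖ * ‖((ratPlusSymbol f₀ 0 : ℚ) : ℚ_[p])‖ := by
    rw [hx, Rat.cast_mul, Rat.cast_mul, norm_mul, norm_mul, hu, one_mul]
  rw [hx, Rat.cast_mul, Rat.cast_mul, norm_mul, norm_mul, hu, one_mul, h0]
  have hmax := hf₀.norm_ratPlusSymbol_val_div_le_max_of_multiplicative hp2 hmult m a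
  calc ‖((ϖ₀ : ℚ) : ℚ_[p])‖ * ‖((ratPlusSymbol f₀ ((a.val : ℚ) / (p : ℚ) ^ m) : ℚ) : ℚ_[p])‖
      ≤ ‖((ϖ₀ : ℚ) : ℚ_[p])‖ * max 1 ‖((ratPlusSymbol f₀ 0 : ℚ) : ℚ_[p])‖ :=
        mul_le_mul_of_nonneg_left (by exact_mod_cast hmax) (norm_nonneg _)
    _ = max ‖((ϖ₀ : ℚ) : ℚ_[p])‖ (‖((ϖ₀ : ℚ) : ℚ_[p])‖ * ‖((ratPlusSymbol f₀ 0 : ℚ) : ℚ_[p])‖) := by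
        rw [mul_max_of_nonneg _ _ (norm_nonneg _), mul_one]

/-- **Rank-free x-currency road** (T33): odd multiplicative `p`, ONE newform `f₀` of `W`, its period
ratio `ϖ₀` with `‖ϖ₀‖_p ≤ 1`, a unit `u`, a table `x = u·ϖ₀·[·]⁺_{f₀}` with `‖x 0‖_p ≤ 1`, and ONE
level `n₀` with `p^{n₀} > k` and `‖RS^x k n₀‖_p = 1` ⟹ `Iwasawa.UnitCoeffAt W p n`.
[cite: MazurTateTeitelbaum1986Invent, §I.10 Prop., §I.12–I.14] [cite: SteinWuthrich2013, §3 and §4.2] -/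
theorem unitCoeffAt_of_symbolTable_rankFree (hp2 : p ≠ 2)
    (hmult : W.HasMultiplicativeReductionAtPrime p)
    {N₀ : ℕ} [NeZero N₀] {f₀ : CuspForm (Gamma0 N₀) 2}
    (hf₀ : IsNewformOf W f₀) {ϖ₀ : ℚ} (hϖ₀ : (ϖ₀ : ℝ) * W.realPeriodRat = plusPeriod f₀)
    (hϖ₀' : ‖((ϖ₀ : ℚ) : ℚ_[p])‖ ≤ 1) {u : ℚ} (hu : ‖((u : ℚ) : ℚ_[p])‖ = 1) {x : ℚ → ℚ}
    (hx : ∀ r : ℚ, x r = u * ϖ₀ * ratPlusSymbol f₀ r) (hx0 : ‖(x 0 : ℚ_[p])‖ ≤ 1) {n : ℕ}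
    (hns : ¬ W.HasSplitMultiplicativeReductionAtPrime p →
        ∃ (n₀ : ℕ) (RS : ℕ → ℕ → ℚ_[p]),
          (∀ k m : ℕ, RS k m =
            ∑ᶠ ξ : rootsOfUnity (torsionOrder p) ℤ_[p], ∑ s : ZMod (p ^ m),
              (fun (m : ℕ) (a : ZMod (p ^ m)) ↦
                  (-1 : ℚ_[p]) ^ m * (x ((a.val : ℚ) / (p : ℚ) ^ m) : ℚ_[p]))
                (m + cyclotomicExponent p)
                  (PadicInt.toZModPow (m + cyclotomicExponent p) ((ξ : ℤ_[p]ˣ) : ℤ_[p]) *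
                    (cyclotomicGenerator p : ZMod (p ^ (m + cyclotomicExponent p))) ^ s.val) *
                ((s.val.choose k : ℕ) : ℚ_[p])) ∧
          n < p ^ n₀ ∧ ‖RS n n₀‖ = 1)
    (hs : W.HasSplitMultiplicativeReductionAtPrime p →
        ∃ (n₀ : ℕ) (RS : ℕ → ℕ → ℚ_[p]),
          (∀ k m : ℕ, RS k m =
            ∑ᶠ ξ : rootsOfUnity (torsionOrder p) ℤ_[p], ∑ s : ZMod (p ^ m),
              (fun (m : ℕ) (a : ZMod (p ^ m)) ↦ (x ((a.val : ℚ) / (p : ℚ) ^ m) : ℚ_[p]))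
                (m + cyclotomicExponent p)
                  (PadicInt.toZModPow (m + cyclotomicExponent p) ((ξ : ℤ_[p]ˣ) : ℤ_[p]) *
                    (cyclotomicGenerator p : ZMod (p ^ (m + cyclotomicExponent p))) ^ s.val) *
                ((s.val.choose k : ℕ) : ℚ_[p])) ∧
          n + 1 < p ^ n₀ ∧ ‖RS (n + 1) n₀‖ = 1) :
    Iwasawa.UnitCoeffAt W p n := by
  have hC : ∀ (m : ℕ) (a : ZMod (p ^ m)), ‖(x ((a.val : ℚ) / (p : ℚ) ^ m) : ℚ_[p])‖ ≤ 1 :=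
    fun m a ↦ (norm_symbolTable_le_max W p hp2 hmult hf₀ hu hx m a).trans (max_le hϖ₀' hx0)
  have hlt1 : (1 : ℝ) * (p : ℝ)⁻¹ < 1 := by
    rw [one_mul]
    exact inv_lt_one_of_one_lt₀ (by exact_mod_cast (Fact.out : p.Prime).one_lt)
  refine @X11b.ClassClosure.unitCoeffAt_of_symbolTable_modP W _ p _ hmult N₀ _ f₀ hf₀ ϖ₀ hϖ₀ u hu x hx n ?_ ?_
  · intro h
    obtain ⟨n₀, RS, hRS, hk, hunit⟩ := hns h
    exact ⟨1, n₀, RS, hRS, hC, hk, by rw [hunit]; exact hlt1, hunit⟩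
  · intro h
    obtain ⟨n₀, RS, hRS, hk, hunit⟩ := hs h
    exact ⟨1, n₀, RS, hRS, hC, hk, by rw [hunit]; exact hlt1, hunit⟩

/-- **T33 road for the X11a μ-records**: `W` globally minimal in class X11a (odd multiplicative `p`,
`E[p]` irreducible), Mazur's fact for `‖ϖ₀‖_p = 1`, a table `x` with `hx` and `‖x 0‖_p ≤ 1`, ONE
level `n₀` with a unit Riemann sum at index `k < p^{n₀}` ⟹ `X11a.MuAnZeroAt W p`.
[cite: Mazur1978, Cor. 4.1] [cite: MazurTateTeitelbaum1986Invent, §I.10 Prop., §I.12–I.14] -/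
theorem muAnZeroAt_of_symbolTable_of_mazur_rankFree [W.IsGloballyMinimal]
    (hM : mazur_not_dvd_maninConstant_of_odd) (hp2 : p ≠ 2)
    (hmult : W.HasMultiplicativeReductionAtPrime p) (hirr : W.HasIrreducibleModPGaloisRep p)
    {N₀ : ℕ} [NeZero N₀] {f₀ : CuspForm (Gamma0 N₀) 2}
    (hf₀ : IsNewformOf W f₀) {ϖ₀ : ℚ} (hϖ₀ : (ϖ₀ : ℝ) * W.realPeriodRat = plusPeriod f₀)
    {u : ℚ} (hu : ‖((u : ℚ) : ℚ_[p])‖ = 1) {x : ℚ → ℚ}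
    (hx : ∀ r : ℚ, x r = u * ϖ₀ * ratPlusSymbol f₀ r) (hx0 : ‖(x 0 : ℚ_[p])‖ ≤ 1) {n : ℕ}
    (hns : ¬ W.HasSplitMultiplicativeReductionAtPrime p →
        ∃ (n₀ : ℕ) (RS : ℕ → ℕ → ℚ_[p]),
          (∀ k m : ℕ, RS k m =
            ∑ᶠ ξ : rootsOfUnity (torsionOrder p) ℤ_[p], ∑ s : ZMod (p ^ m),
              (fun (m : ℕ) (a : ZMod (p ^ m)) ↦
                  (-1 : ℚ_[p]) ^ m * (x ((a.val : ℚ) / (p : ℚ) ^ m) : ℚ_[p]))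
                (m + cyclotomicExponent p)
                  (PadicInt.toZModPow (m + cyclotomicExponent p) ((ξ : ℤ_[p]ˣ) : ℤ_[p]) *
                    (cyclotomicGenerator p : ZMod (p ^ (m + cyclotomicExponent p))) ^ s.val) *
                ((s.val.choose k : ℕ) : ℚ_[p])) ∧
          n < p ^ n₀ ∧ ‖RS n n₀‖ = 1)
    (hs : W.HasSplitMultiplicativeReductionAtPrime p →
        ∃ (n₀ : ℕ) (RS : ℕ → ℕ → ℚ_[p]),
          (∀ k m : ℕ, RS k m =
            ∑ᶠ ξ : rootsOfUnity (torsionOrder p) ℤ_[p], ∑ s : ZMod (p ^ m),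
              (fun (m : ℕ) (a : ZMod (p ^ m)) ↦ (x ((a.val : ℚ) / (p : ℚ) ^ m) : ℚ_[p]))
                (m + cyclotomicExponent p)
                  (PadicInt.toZModPow (m + cyclotomicExponent p) ((ξ : ℤ_[p]ˣ) : ℤ_[p]) *
                    (cyclotomicGenerator p : ZMod (p ^ (m + cyclotomicExponent p))) ^ s.val) *
                ((s.val.choose k : ℕ) : ℚ_[p])) ∧
          n + 1 < p ^ n₀ ∧ ‖RS (n + 1) n₀‖ = 1) :
    _root_.Summit.BirchSwinnertonDyer.Rank1Residual.X11a.MuAnZeroAt W p :=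
  -- = ty2's door input `X11a.MuAnZeroAt` = ty3's `Record.MuClaim` body (NOT the good-ordinary
  -- `Literature.…Rank1Residual.MuAnZeroAt` of MuLambdaCarriers.lean)
  Iwasawa.muAnZeroAt_of_unitCoeffAt
    (unitCoeffAt_of_symbolTable_rankFree W p hp2 hmult hf₀ hϖ₀
      (le_of_eq (X11b.ClassClosure.norm_ratCast_periodRatio_eq_one_of_mazur W p hM hp2 hmult hirr hf₀ hϖ₀))
      hu hx hx0 hns hs)


end RankFree

/-! ### §2 The doors on the class: the table ⇒ the μ-claim ⇒ crux-U currency, by regime -/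

section ClassDoors

variable {W : WeierstrassCurve ℚ} [W.IsElliptic] [W.IsGloballyMinimal] {p : ℕ} [Fact p.Prime]

/-- **The μ-claim of a non-surjective (or any) X11a pair from its symbol table**: `p ≠ 2`, `Mult`,
`Irr` come from the class; the rest is §1's `muAnZeroAt_of_symbolTable_of_mazur_rankFree`.
[cite: MazurTateTeitelbaum1986Invent, §I.10 Prop., §I.12–I.14] [cite: Mazur1978, Cor. 4.1] -/
theorem _root_.Summit.BirchSwinnertonDyer.Rank1Residual.ClassX11a.muAnZeroAt_of_symbolTable
    (hM : mazur_not_dvd_maninConstant_of_odd) (hX : ClassX11a W p)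
    {N₀ : ℕ} [NeZero N₀] {f₀ : CuspForm (Gamma0 N₀) 2}
    (hf₀ : IsNewformOf W f₀) {ϖ₀ : ℚ} (hϖ₀ : (ϖ₀ : ℝ) * W.realPeriodRat = plusPeriod f₀)
    {u : ℚ} (hu : ‖((u : ℚ) : ℚ_[p])‖ = 1) {x : ℚ → ℚ}
    (hx : ∀ r : ℚ, x r = u * ϖ₀ * ratPlusSymbol f₀ r) (hx0 : ‖(x 0 : ℚ_[p])‖ ≤ 1) {n : ℕ}
    (hns : ¬ W.HasSplitMultiplicativeReductionAtPrime p →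
        ∃ (n₀ : ℕ) (RS : ℕ → ℕ → ℚ_[p]),
          (∀ k m : ℕ, RS k m =
            ∑ᶠ ξ : rootsOfUnity (torsionOrder p) ℤ_[p], ∑ s : ZMod (p ^ m),
              (fun (m : ℕ) (a : ZMod (p ^ m)) ↦
                  (-1 : ℚ_[p]) ^ m * (x ((a.val : ℚ) / (p : ℚ) ^ m) : ℚ_[p]))
                (m + cyclotomicExponent p)
                  (PadicInt.toZModPow (m + cyclotomicExponent p) ((ξ : ℤ_[p]ˣ) : ℤ_[p]) *
                    (cyclotomicGenerator p : ZMod (p ^ (m + cyclotomicExponent p))) ^ s.val) *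
                ((s.val.choose k : ℕ) : ℚ_[p])) ∧
          n < p ^ n₀ ∧ ‖RS n n₀‖ = 1)
    (hs : W.HasSplitMultiplicativeReductionAtPrime p →
        ∃ (n₀ : ℕ) (RS : ℕ → ℕ → ℚ_[p]),
          (∀ k m : ℕ, RS k m =
            ∑ᶠ ξ : rootsOfUnity (torsionOrder p) ℤ_[p], ∑ s : ZMod (p ^ m),
              (fun (m : ℕ) (a : ZMod (p ^ m)) ↦ (x ((a.val : ℚ) / (p : ℚ) ^ m) : ℚ_[p]))
                (m + cyclotomicExponent p)
                  (PadicInt.toZModPow (m + cyclotomicExponent p) ((ξ : ℤ_[p]ˣ) : ℤ_[p]) *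
                    (cyclotomicGenerator p : ZMod (p ^ (m + cyclotomicExponent p))) ^ s.val) *
                ((s.val.choose k : ℕ) : ℚ_[p])) ∧
          n + 1 < p ^ n₀ ∧ ‖RS (n + 1) n₀‖ = 1) :
    X11a.MuAnZeroAt W p :=
  muAnZeroAt_of_symbolTable_of_mazur_rankFree W p hM hX.ne_two hX.mult hX.irr hf₀ hϖ₀ hu hx hx0 hns hs

/-- **TABLE DOOR, NON-SPLIT regime (crux-U currency)**: at a non-split non-surjective X11a pair, the
symbol table `x` (`hx`, `‖x 0‖ ≤ 1`), ONE level `n₀` with the exact SIGNED Riemann sums `RS` of `x`,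
an index `n < p^{n₀}` and `‖RS n n₀‖_p = 1`, Mazur's fact and the ten facts of part 6 give
`Typed.MissingUpperBoundAt W p` — the μ-claim is DERIVED (§1) and fed to part 6's GS-free door
`ClassX11a.missingUpperBoundAt_of_muAnZeroAt_of_not_surj_of_nonsplit`. PER PAIR (E1 currency).
[cite: MazurTateTeitelbaum1986Invent, §I.10 Prop., §I.12–I.14] [cite: Kato2004Asterisque, §17.13 (pp. 279–280)]
[cite: Wuthrich2014, Cor. 18 (p. 398)] [cite: Miller2011LMS, Def. 1.1] -/
theorem _root_.Summit.BirchSwinnertonDyer.Rank1Residual.ClassX11a.missingUpperBoundAt_of_symbolTable_of_not_surj_of_nonsplit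
    (hJs : thm61_splitMultiplicative) (hJn : thm61_nonsplitMultiplicative)
    (hGZK : rank_eq_analyticRank_of_analyticRank_le_one) (hpar : nonempty_modularParametrizationData)
    (h12 : Kato2004.thm12_4)
    (hns' : Kato2004.exists_multDivisibilityInputs_nonsplit)
    (hsp : Kato2004.exists_multDivisibilityInputs_split)
    (h15 : thm15_isTorsion_multiplicative_rat)
    (h18 : Wuthrich2014.corollary18_padicLFunction_mem_iwasawaAlgebra_multiplicative)
    (hfine : Kato2004.exists_multDivisibilityInputs_fine)
    (hM : mazur_not_dvd_maninConstant_of_odd) (hX : ClassX11a W p) (hnsj : ¬ Surj W p)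
    (hnsp : ¬ W.HasSplitMultiplicativeReductionAtPrime p)
    {N₀ : ℕ} [NeZero N₀] {f₀ : CuspForm (Gamma0 N₀) 2}
    (hf₀ : IsNewformOf W f₀) {ϖ₀ : ℚ} (hϖ₀ : (ϖ₀ : ℝ) * W.realPeriodRat = plusPeriod f₀)
    {u : ℚ} (hu : ‖((u : ℚ) : ℚ_[p])‖ = 1) {x : ℚ → ℚ}
    (hx : ∀ r : ℚ, x r = u * ϖ₀ * ratPlusSymbol f₀ r) (hx0 : ‖(x 0 : ℚ_[p])‖ ≤ 1)
    (n n₀ : ℕ) (RS : ℕ → ℕ → ℚ_[p])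
    (hRS : ∀ k m : ℕ, RS k m =
          ∑ᶠ ξ : rootsOfUnity (torsionOrder p) ℤ_[p], ∑ s : ZMod (p ^ m),
            (fun (m : ℕ) (a : ZMod (p ^ m)) ↦
                (-1 : ℚ_[p]) ^ m * (x ((a.val : ℚ) / (p : ℚ) ^ m) : ℚ_[p]))
              (m + cyclotomicExponent p)
                (PadicInt.toZModPow (m + cyclotomicExponent p) ((ξ : ℤ_[p]ˣ) : ℤ_[p]) *
                  (cyclotomicGenerator p : ZMod (p ^ (m + cyclotomicExponent p))) ^ s.val) *
              ((s.val.choose k : ℕ) : ℚ_[p]))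
    (hk : n < p ^ n₀) (hunit : ‖RS n n₀‖ = 1) : MissingUpperBoundAt W p :=
  hX.missingUpperBoundAt_of_muAnZeroAt_of_not_surj_of_nonsplit hJs hJn hGZK hpar h12 hns' hsp h15 h18 hfine
    hnsj hnsp
    (hX.muAnZeroAt_of_symbolTable hM hf₀ hϖ₀ hu hx hx0 (n := n)
      (fun _ => ⟨n₀, RS, hRS, hk, hunit⟩) (fun h => absurd h hnsp))

/-- **TABLE DOOR, SPLIT regime (crux-U currency)**: at a split non-surjective X11a pair, the symbol
table `x` (`hx`, `‖x 0‖ ≤ 1`), ONE level `n₀` with the exact UNSIGNED Riemann sums `RS` of `x`, an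
index `n + 1 < p^{n₀}` (past the trivial zero) and `‖RS (n+1) n₀‖_p = 1`, Mazur's fact, the ten facts
and Greenberg–Stevens at the pair give `Typed.MissingUpperBoundAt W p` (§1 ∘ part 6
`ClassX11a.missingUpperBoundAt_of_muAnZeroAt_of_not_surj`). PER PAIR (E1 currency). On this locus the
witness index is `≥ 2` (part 6 §1b census: the Tate extension splits locally).
[cite: MazurTateTeitelbaum1986Invent, §I.10 Prop., §I.12–I.14] [cite: GreenbergStevens1993, Thm. (0.3) (p. 407)]
[cite: Kato2004Asterisque, §17.13 (pp. 279–280)] [cite: Wuthrich2014, Cor. 18 (p. 398)] [cite: Miller2011LMS, Def. 1.1] -/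
theorem _root_.Summit.BirchSwinnertonDyer.Rank1Residual.ClassX11a.missingUpperBoundAt_of_symbolTable_of_not_surj_of_split
    (hJs : thm61_splitMultiplicative) (hJn : thm61_nonsplitMultiplicative)
    (hGZK : rank_eq_analyticRank_of_analyticRank_le_one) (hpar : nonempty_modularParametrizationData)
    (h12 : Kato2004.thm12_4)
    (hns' : Kato2004.exists_multDivisibilityInputs_nonsplit)
    (hsp : Kato2004.exists_multDivisibilityInputs_split)
    (h15 : thm15_isTorsion_multiplicative_rat)
    (h18 : Wuthrich2014.corollary18_padicLFunction_mem_iwasawaAlgebra_multiplicative)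
    (hfine : Kato2004.exists_multDivisibilityInputs_fine)
    (hGS : greenberg_stevens (W := W) (p := p))
    (hM : mazur_not_dvd_maninConstant_of_odd) (hX : ClassX11a W p) (hnsj : ¬ Surj W p)
    (hsplit : W.HasSplitMultiplicativeReductionAtPrime p)
    {N₀ : ℕ} [NeZero N₀] {f₀ : CuspForm (Gamma0 N₀) 2}
    (hf₀ : IsNewformOf W f₀) {ϖ₀ : ℚ} (hϖ₀ : (ϖ₀ : ℝ) * W.realPeriodRat = plusPeriod f₀)
    {u : ℚ} (hu : ‖((u : ℚ) : ℚ_[p])‖ = 1) {x : ℚ → ℚ}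
    (hx : ∀ r : ℚ, x r = u * ϖ₀ * ratPlusSymbol f₀ r) (hx0 : ‖(x 0 : ℚ_[p])‖ ≤ 1)
    (n n₀ : ℕ) (RS : ℕ → ℕ → ℚ_[p])
    (hRS : ∀ k m : ℕ, RS k m =
          ∑ᶠ ξ : rootsOfUnity (torsionOrder p) ℤ_[p], ∑ s : ZMod (p ^ m),
            (fun (m : ℕ) (a : ZMod (p ^ m)) ↦ (x ((a.val : ℚ) / (p : ℚ) ^ m) : ℚ_[p]))
              (m + cyclotomicExponent p)
                (PadicInt.toZModPow (m + cyclotomicExponent p) ((ξ : ℤ_[p]ˣ) : ℤ_[p]) *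
                  (cyclotomicGenerator p : ZMod (p ^ (m + cyclotomicExponent p))) ^ s.val) *
              ((s.val.choose k : ℕ) : ℚ_[p]))
    (hk : n + 1 < p ^ n₀) (hunit : ‖RS (n + 1) n₀‖ = 1) : MissingUpperBoundAt W p :=
  hX.missingUpperBoundAt_of_muAnZeroAt_of_not_surj hJs hJn hGZK hpar h12 hns' hsp h15 h18 hfine hGS hnsj
    (hX.muAnZeroAt_of_symbolTable hM hf₀ hϖ₀ hu hx hx0 (n := n)
      (fun h => absurd hsplit h) (fun _ => ⟨n₀, RS, hRS, hk, hunit⟩))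

end ClassDoors

end Summit.BirchSwinnertonDyer.Rank1Residual.X11a

end
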